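import Summits.AtomisticToContinuum.FouriersLaw.Theorems.EmbeddedDrudeMourreFGRGapBranchA
import Literature.MathematicalPhysics.KineticTheory.ZeroWavenumberSpace
import HarnessLib

/-!
# Rigidity of the frequency-0 pair threshold — stub `stub_pairThreshold` of line `swap-odd-threshold-rigidity`
(crux `EmbeddedDrudeMourre.MourreDissolution`, item stmt-AtomisticToContinuum-12594; helper file, `--supports`)

Registered stub A of the checked skeleton of line `swap-odd-threshold-rigidity` (lead c7), in the
skeleton's stub namespace `Summit.AtomisticToContinuum.FouriersLaw.Theorems.MourreDissolution`.

On the `(2,2)` zero-momentum shell of the pinned band `ω(k) = √(ω₂ + 2 − 2 cos k)` (`ω₂ > 0`), a zero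
of the resonance function `Ω(k₁,k₂,k₃) = ω(k₁) + ω(k₂) − ω(k₃) − ω(k₁+k₂−k₃)` at which the four
group velocities `v = ω' = sin k / ω(k)` coincide lies on the exchange diagonal:
`k₃ ≡ k₁ (mod 2π)` or `k₃ ≡ k₂ (mod 2π)`.

Proof (≈ 10 lines over the FGRGap line's landed two-root algebra, file `…FGRGapBranchA`): either
`k₃ − k₁ ∈ 2πℤ` (first alternative), or, off that diagonal, `k₂` is a zero of `Ω(k₁, ·, k₃)` with
`∂₂Ω = v(k₂) − v(k₁+k₂−k₃) = 0` (from `v₂ = v₃ = v₄`), hence by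
`FGRGap.FoldJetRigidity.Branch.modEq_of_velocity_eq` it is congruent mod `2π` to every zero of
`Ω(k₁, ·, k₃)`, in particular to the exchange zero `k₃` (`PhononBoltzmann.resonanceFn_self`) — the
second alternative. Only `Ω = 0`, `v₂ = v₃`, `v₃ = v₄` are used; `v₁ = v₂` is idle.
-/

noncomputable section

namespace Summit.AtomisticToContinuum.FouriersLaw.Theorems.MourreDissolution

open MeasureTheory Filter Set Function Topology
open scoped InnerProductSpace ENNReal
open Literature.MathematicalPhysics.KineticTheory
open Literature.MathematicalPhysics.KineticTheory.HeatConduction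
open Literature.MathematicalPhysics.KineticTheory.PhononBoltzmann

/-- **Stub A of line `swap-odd-threshold-rigidity` (`stub_pairThreshold`): rigidity of the
frequency-0 threshold of the free pair resonance.** For `ω₂ > 0`, a zero of
`Ω(k₁,k₂,k₃) = resonanceFn ω₂ k₁ k₂ k₃` with
`v(k₁) = v(k₂) = v(k₃) = v(k₁+k₂−k₃)` (`v = groupVelocity ω₂`) has `k₃ ≡ k₁` or `k₃ ≡ k₂ (mod 2π)`:
the level-0 critical set of the free pair resonance (co-moving collisions) lies on the exchange
diagonal, where every collision bracket vanishes. Reduces to the two-root algebra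
`FGRGap.FoldJetRigidity.Branch.modEq_of_velocity_eq` and the exchange zero `resonanceFn_self`.
[folklore] -/
theorem stub_pairThreshold :
    ∀ ω₂ : ℝ, 0 < ω₂ → ∀ k₁ k₂ k₃ : ℝ,
      resonanceFn ω₂ k₁ k₂ k₃ = 0 →
      groupVelocity ω₂ k₁ = groupVelocity ω₂ k₂ →
      groupVelocity ω₂ k₂ = groupVelocity ω₂ k₃ →
      groupVelocity ω₂ k₃ = groupVelocity ω₂ (k₁ + k₂ - k₃) →
      (∃ n : ℤ, k₃ = k₁ + 2 * Real.pi * n) ∨ (∃ n : ℤ, k₃ = k₂ + 2 * Real.pi * n) := by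
  intro ω₂ hω k₁ k₂ k₃ hΩ _h12 h23 h34
  by_cases hdiag : ∃ n : ℤ, k₃ - k₁ = n * (2 * Real.pi)
  · obtain ⟨n, hn⟩ := hdiag
    exact Or.inl ⟨n, by linarith⟩
  · push Not at hdiag
    have hv : groupVelocity ω₂ k₂ = groupVelocity ω₂ (k₁ + k₂ - k₃) := h23.trans h34
    obtain ⟨n, hn⟩ :=
      FGRGap.FoldJetRigidity.Branch.modEq_of_velocity_eq hω hdiag hΩ (resonanceFn_self ω₂ k₁ k₃) hv
    exact Or.inr ⟨n, by linarith⟩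

end Summit.AtomisticToContinuum.FouriersLaw.Theorems.MourreDissolution

end
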